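import Summits.SmoothPoincare4.SmoothPoincare4.Theses.SullivanDual
import Summits.SmoothPoincare4.SmoothPoincare4.Theorems.SullivanDualWitnessChargeStubBubbleConfinementSubharmonic
import Summits.SmoothPoincare4.SmoothPoincare4.Theorems.SullivanDualWitnessChargeStubBubbleConfinementHolomorphic
import Summits.SmoothPoincare4.SmoothPoincare4.Theorems.SullivanDualWitnessChargeStubCollarChart
import Literature.Geometry.Symplectic.JHolomorphicMap
import Literature.Geometry.Symplectic.GromovR4StdModel

/-!
# Stub `stub_bubbleConfinement` of line `Sketch` (pencil-incompleteness) for crux `WitnessCharge`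
(item stmt-SmoothPoincare4-7824; route `SullivanDual`, crux
`Summit.SmoothPoincare4.SmoothPoincare4.Theses.SullivanDual.WitnessCharge`; checked skeleton
`Cruxes/WitnessCharge/Lines/Sketch.lean`)

**Bubble confinement (the maximum principle of the line).**  Let `J` be standard on the
punctured chart ball `B_{ε'}` at `p` (closed ball inside the chart target): in the inverted
recentred chart `y = ι(e x - e p)` it is the standard structure `J₀ = stdComplexStructure` of
`ℝ⁴ = ℂ²` (`A (J v) = J₀ (A v)`, `A = Dι ∘ De` — this is what the crux's clause
`⟪A(Jv), b⟫ = ω₀(Av, b)` says, `eq_stdComplexStructure_of_forall_inner`).  Then a non-constant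
`C^∞` `J`-holomorphic `u : ℂ → Σ ∖ p` whose image avoids SOME punctured chart ball `B_η` avoids
all of `B_{ε'}`.

Proof (`bubbleConfinement_of`, for any Hausdorff smooth `4`-manifold).  On the open set
`U = u⁻¹(B_{ε'})` the map `W = ι ∘ (e - e p) ∘ u : U → ℝ⁴` is smooth and flat `J₀`-holomorphic
(chain rule for `mfderiv`), with `‖W‖ = ‖e u - e p‖⁻¹ ∈ (1/ε', 1/η]`.  The function
`φ = ‖W‖² - ε'⁻²` on `U`, `0` off `U`, is continuous (on `∂U`, `‖e u - e p‖ = ε'` because the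
closed chart ball is compact, hence closed), non-negative, bounded, and on `U = {φ > 0}` it is
`C²` with `Δ φ = 2(‖W_s‖² + ‖W_t‖²) ≥ 0` (part 2, `laplacian_norm_sq_of_jHolomorphic`).  By the
Liouville theorem for such functions (part 1, `subharmonic_liouville`) `φ` is constant; if some
`u z₀ ∈ B_{ε'}` the constant is positive, so `U = ℂ` and `Δ φ = 0` forces `DW = 0`, `W` constant,
`u` constant (`ι` and `e` are injective) — contradicting non-constancy.  No Liouville theorem for
holomorphic maps and no compactness of `Σ` is needed.

References: M. Gromov, *Pseudo holomorphic curves in symplectic manifolds*, Invent. Math. 82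
(1985), 2.3.D (`J`-curves do not touch pseudoconvex collars from inside) [Gromov1985];
D. McDuff, D. Salamon, *Introduction to symplectic topology*, 3rd ed. (2017), §4.5
[McDuffSalamon2017]; T. Ransford, *Potential theory in the complex plane* (1995), §2.3
[Ransford1995].
-/

noncomputable section

-- the registered namespace `Summit.SmoothPoincare4.SmoothPoincare4.…` repeats a component
set_option linter.dupNamespace false

open scoped Manifold ContDiff Topology RealInnerProductSpace
open Set Filter Metric Laplacian InnerProductSpace Literature.Geometry.Kaehler
  Literature.Geometry.Symplectic Literature.Topology.FourManifolds

namespace Summit.SmoothPoincare4.SmoothPoincare4.Theorems.WitnessCharge.PencilIncompleteness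

/-! ### The inverted chart along a smooth map from `ℂ` -/

section InvertedChart

variable {M : Type*} [TopologicalSpace M] [T2Space M] [ChartedSpace (EuclideanSpace ℝ (Fin 4)) M]
  [IsManifold (𝓡 4) ∞ M] {p : M} {u : ℂ → punctured p}

/-- Along a `C^∞` map `u : ℂ → M ∖ p`, the chart expression `W = ι(e u - e p)` is smooth at
points mapped into the chart source (`contMDiffAt_inversion_extChartAt_sub` of the collar file
of the line, composed with `u`; `ContMDiff = ContDiff` between vector spaces). [folklore] -/
theorem contDiffAt_inversion_extChartAt_sub_comp (hu : ContMDiff 𝓘(ℝ, ℂ) (𝓡 4) ∞ u) {z : ℂ}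
    (hz : (u z).1 ∈ (chartAt (EuclideanSpace ℝ (Fin 4)) p).source) :
    ContDiffAt ℝ ∞
      (fun x : ℂ => inversion (extChartAt (𝓡 4) p (u x).1 - extChartAt (𝓡 4) p p)) z :=
  contMDiffAt_iff_contDiffAt.1 ((contMDiffAt_inversion_extChartAt_sub p hz).comp z (hu z))

/-- … with derivative `DW(z) v = Dι (De (du(z) v))` (chain rule
`hasMFDerivAt_inversion_extChartAt_sub`, and `mfderiv = fderiv` on vector spaces). [folklore] -/
theorem fderiv_inversion_extChartAt_sub_comp_apply (hu : ContMDiff 𝓘(ℝ, ℂ) (𝓡 4) ∞ u) {z : ℂ}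
    (hz : (u z).1 ∈ (chartAt (EuclideanSpace ℝ (Fin 4)) p).source) (v : ℂ) :
    fderiv ℝ (fun x : ℂ => inversion (extChartAt (𝓡 4) p (u x).1 - extChartAt (𝓡 4) p p)) z v =
      fderiv ℝ inversion (extChartAt (𝓡 4) p (u z).1 - extChartAt (𝓡 4) p p)
        (mfderiv (𝓡 4) 𝓘(ℝ, EuclideanSpace ℝ (Fin 4))
          (fun x : punctured p => extChartAt (𝓡 4) p x.1) (u z) (mfderiv 𝓘(ℝ, ℂ) (𝓡 4) u z v)) := by
  have h := ((hasMFDerivAt_inversion_extChartAt_sub p (u z) hz).comp z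
    ((hu.mdifferentiableAt (by simp)).hasMFDerivAt (x := z))).mfderiv
  rw [mfderiv_eq_fderiv] at h
  exact DFunLike.congr_fun h v

end InvertedChart

/-! ### Bubble confinement -/

section Confinement

variable {M : Type*} [TopologicalSpace M] [T2Space M] [ChartedSpace (EuclideanSpace ℝ (Fin 4)) M]
  [IsManifold (𝓡 4) ∞ M]

/-- **Bubble confinement** on a Hausdorff smooth `4`-manifold: for `J` standard (in the inverted
chart) on the punctured `ε'`-chart ball at `p`, closed ball inside the chart target, a
non-constant `C^∞` `J`-holomorphic `u : ℂ → M ∖ p` avoiding some punctured chart ball `B_η`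
avoids `B_{ε'}` (maximum principle for the bounded subharmonic function
`max(‖ι(e u - e p)‖² - ε'⁻², 0)`). [cite: Gromov1985, 2.3.D] -/
theorem bubbleConfinement_of (p : M)
    (J : ∀ x : punctured p, TangentSpace (𝓡 4) x →L[ℝ] TangentSpace (𝓡 4) x) (ε' : ℝ)
    (hε' : 0 < ε')
    (hball : closedBall (extChartAt (𝓡 4) p p) ε' ⊆ (extChartAt (𝓡 4) p).target)
    (hstd : ∀ x : punctured p, InPuncturedChartBall p ε' x →
      ∀ (v : TangentSpace (𝓡 4) x) (b : EuclideanSpace ℝ (Fin 4)),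
        inner ℝ (fderiv ℝ inversion (extChartAt (𝓡 4) p x.1 - extChartAt (𝓡 4) p p)
          (mfderiv (𝓡 4) 𝓘(ℝ, EuclideanSpace ℝ (Fin 4))
            (fun z : punctured p => extChartAt (𝓡 4) p z.1) x (J x v))) b
        = stdSymplecticForm (fderiv ℝ inversion (extChartAt (𝓡 4) p x.1 - extChartAt (𝓡 4) p p)
          (mfderiv (𝓡 4) 𝓘(ℝ, EuclideanSpace ℝ (Fin 4))
            (fun z : punctured p => extChartAt (𝓡 4) p z.1) x v)) b)
    (u : ℂ → punctured p) (hu : ContMDiff 𝓘(ℝ, ℂ) (𝓡 4) ∞ u) (hne : ∃ z z' : ℂ, u z ≠ u z')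
    (hhol : IsJHolomorphic (𝓡 4) J u)
    (hη : ∃ η : ℝ, 0 < η ∧ ∀ z : ℂ, ¬ InPuncturedChartBall p η (u z)) :
    ∀ z : ℂ, ¬ InPuncturedChartBall p ε' (u z) := by
  classical
  intro z₀ hz₀
  obtain ⟨η, hη, havoid⟩ := hη
  set e := extChartAt (𝓡 4) p with he
  -- the open set `U = u⁻¹(B_{ε'})`
  set U : Set ℂ := {z | InPuncturedChartBall p ε' (u z)} with hU_def
  have hval : Continuous fun z => (u z).1 := continuous_subtype_val.comp hu.continuous
  have hUopen : IsOpen U := (isOpen_setOf_inPuncturedChartBall p ε').preimage hu.continuous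
  have hUlt : ∀ z ∈ U, ‖e (u z).1 - e p‖ < ε' := fun z hz => by
    have h := hz.2
    rwa [mem_ball, dist_eq_norm] at h
  have hne0 : ∀ z, (u z).1 ∈ (chartAt (EuclideanSpace ℝ (Fin 4)) p).source → e (u z).1 - e p ≠ 0 :=
    fun z hz => extChartAt_sub_ne_zero p hz
  have hUge : ∀ z ∈ U, η ≤ ‖e (u z).1 - e p‖ := by
    intro z hz
    by_contra hlt
    push Not at hlt
    exact havoid z ⟨hz.1, by rwa [mem_ball, dist_eq_norm]⟩
  -- the chart expression `W` and the comparison function `φ`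
  set W : ℂ → EuclideanSpace ℝ (Fin 4) := fun z => inversion (e (u z).1 - e p) with hW_def
  have hWnorm : ∀ z, ‖W z‖ = ‖e (u z).1 - e p‖⁻¹ := fun z => norm_inversion _
  set f : ℂ → ℝ := fun z => ‖W z‖ ^ 2 - (ε' ^ 2)⁻¹ with hf_def
  set φ : ℂ → ℝ := fun z => if z ∈ U then f z else 0 with hφ_def
  have hfU : ∀ z ∈ U, 0 < f z ∧ f z ≤ (η ^ 2)⁻¹ := by
    intro z hz
    have hpos : 0 < ‖e (u z).1 - e p‖ := norm_pos_iff.2 (hne0 z hz.1)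
    have h1 : ‖W z‖ ^ 2 = (‖e (u z).1 - e p‖ ^ 2)⁻¹ := by rw [hWnorm, inv_pow]
    show 0 < ‖W z‖ ^ 2 - (ε' ^ 2)⁻¹ ∧ ‖W z‖ ^ 2 - (ε' ^ 2)⁻¹ ≤ (η ^ 2)⁻¹
    rw [h1]
    have hε2 : 0 < (ε' ^ 2)⁻¹ := by positivity
    constructor
    · have hlt : ‖e (u z).1 - e p‖ ^ 2 < ε' ^ 2 :=
        pow_lt_pow_left₀ (hUlt z hz) hpos.le two_ne_zero
      have := (inv_lt_inv₀ (by positivity) (by positivity)).2 hlt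
      linarith
    · have hle : η ^ 2 ≤ ‖e (u z).1 - e p‖ ^ 2 := pow_le_pow_left₀ hη.le (hUge z hz) 2
      have := (inv_le_inv₀ (by positivity) (by positivity)).2 hle
      linarith
  have hφU : ∀ z ∈ U, φ z = f z := fun z hz => if_pos hz
  have hφU' : ∀ z, z ∉ U → φ z = 0 := fun z hz => if_neg hz
  have hφ0 : ∀ z, 0 ≤ φ z := by
    intro z
    by_cases hz : z ∈ U
    · rw [hφU z hz]; exact (hfU z hz).1.le
    · rw [hφU' z hz]
  have hφpos : ∀ z, 0 < φ z → z ∈ U := by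
    intro z hz
    by_contra h
    rw [hφU' z h] at hz
    exact lt_irrefl _ hz
  have hφbdd : BddAbove (range φ) := by
    refine ⟨(η ^ 2)⁻¹, ?_⟩
    rintro _ ⟨z, rfl⟩
    by_cases hz : z ∈ U
    · rw [hφU z hz]; exact (hfU z hz).2
    · rw [hφU' z hz]; positivity
  have hφf : ∀ z ∈ U, φ =ᶠ[𝓝 z] f := fun z hz =>
    eventually_of_mem (hUopen.mem_nhds hz) fun x hx => hφU x hx
  -- smoothness of `W` over the chart source
  have hWsmooth : ∀ z, (u z).1 ∈ (chartAt (EuclideanSpace ℝ (Fin 4)) p).source →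
      ContDiffAt ℝ 2 W z :=
    fun z hz => (contDiffAt_inversion_extChartAt_sub_comp hu hz).of_le ENat.LEInfty.out
  have hφ2 : ∀ z, 0 < φ z → ContDiffAt ℝ 2 φ z := by
    intro z hz
    have hzU := hφpos z hz
    have hf2 : ContDiffAt ℝ 2 f z := ((hWsmooth z hzU.1).norm_sq ℝ).sub contDiffAt_const
    exact hf2.congr_of_eventuallyEq (hφf z hzU)
  -- the derivative of `W`: `DW v = A (du v)` with `A = Dι ∘ De`, and `A J = J₀ A` on `B_{ε'}`
  set A : ∀ q : punctured p, EuclideanSpace ℝ (Fin 4) →L[ℝ] EuclideanSpace ℝ (Fin 4) := fun q =>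
    (fderiv ℝ inversion (e q.1 - e p)).comp
      (mfderiv (𝓡 4) 𝓘(ℝ, EuclideanSpace ℝ (Fin 4)) (fun x : punctured p => e x.1) q) with hA_def
  have hDW : ∀ z, (u z).1 ∈ (chartAt (EuclideanSpace ℝ (Fin 4)) p).source → ∀ v : ℂ,
      fderiv ℝ W z v = A (u z) (mfderiv 𝓘(ℝ, ℂ) (𝓡 4) u z v) :=
    fun z hz v => fderiv_inversion_extChartAt_sub_comp_apply hu hz v
  have hAJ : ∀ z ∈ U, ∀ w : EuclideanSpace ℝ (Fin 4),
      A (u z) (J (u z) w) = stdComplexStructure (A (u z) w) := by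
    intro z hz w
    have key : fderiv ℝ inversion (e (u z).1 - e p)
        (mfderiv (𝓡 4) 𝓘(ℝ, EuclideanSpace ℝ (Fin 4)) (fun x : punctured p => e x.1) (u z)
          (J (u z) w)) =
        stdComplexStructure (fderiv ℝ inversion (e (u z).1 - e p)
          (mfderiv (𝓡 4) 𝓘(ℝ, EuclideanSpace ℝ (Fin 4)) (fun x : punctured p => e x.1) (u z) w)) :=
      eq_stdComplexStructure_of_forall_inner fun b => hstd (u z) hz w b
    exact key
  have hholW : ∀ z ∈ U, ∀ v : ℂ,
      fderiv ℝ W z (Complex.I * v) = stdComplexStructure (fderiv ℝ W z v) := by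
    intro z hz v
    rw [hDW z hz.1 (Complex.I * v), hDW z hz.1 v, hhol z v]
    exact hAJ z hz _
  have hholW' : ∀ z ∈ U, ∀ᶠ x in 𝓝 z, ∀ v : ℂ,
      fderiv ℝ W x (Complex.I * v) = stdComplexStructure (fderiv ℝ W x v) := fun z hz =>
    eventually_of_mem (hUopen.mem_nhds hz) fun x hx => hholW x hx
  -- the Laplacian of `φ` on `U`
  have hΔφ : ∀ z ∈ U, Δ φ z = 2 * (‖fderiv ℝ W z 1‖ ^ 2 + ‖fderiv ℝ W z Complex.I‖ ^ 2) := by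
    intro z hz
    have h1 : Δ φ z = Δ f z := (laplacian_congr_nhds (hφf z hz)).eq_of_nhds
    have h2 : Δ f z = Δ (fun x => ‖W x‖ ^ 2) z := by
      rw [laplacian_eq_fderiv_fderiv, laplacian_eq_fderiv_fderiv]
      have hfd : fderiv ℝ f = fderiv ℝ fun x => ‖W x‖ ^ 2 := by
        funext x
        exact fderiv_sub_const _
      rw [hfd]
    rw [h1, h2,
      laplacian_norm_sq_of_jHolomorphic stdComplexStructure_sq (hWsmooth z hz.1) (hholW' z hz)]
  have hφΔ : ∀ z, 0 < φ z → 0 ≤ Δ φ z := by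
    intro z hz
    rw [hΔφ z (hφpos z hz)]
    positivity
  -- continuity of `φ`: on `∂U` the chart distance is exactly `ε'`
  set Ubar : Set ℂ := {z | (u z).1 ∈ (chartAt (EuclideanSpace ℝ (Fin 4)) p).source ∧
    e (u z).1 ∈ closedBall (e p) ε'} with hUbar_def
  have hUbar_closed : IsClosed Ubar := (isClosed_closedChartBall p hball).preimage hval
  have hUUbar : U ⊆ Ubar := fun z hz => ⟨hz.1, ball_subset_closedBall hz.2⟩
  have hclU : closure U ⊆ Ubar := closure_minimal hUUbar hUbar_closed
  have hfcont : ∀ z ∈ Ubar, ContinuousAt f z := fun z hz =>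
    (((hWsmooth z hz.1).continuousAt.norm).pow 2).sub continuousAt_const
  have hφc : Continuous φ := by
    rw [hφ_def]
    apply continuous_if
    · intro a ha
      simp only [setOf_mem_eq] at ha
      rw [hUopen.frontier_eq] at ha
      obtain ⟨haU, hanU⟩ := ha
      have haUbar := hclU haU
      have hle : ‖e (u a).1 - e p‖ ≤ ε' := by
        have h := haUbar.2
        rwa [mem_closedBall, dist_eq_norm] at h
      have hge : ε' ≤ ‖e (u a).1 - e p‖ := by
        by_contra hlt
        push Not at hlt
        exact hanU ⟨haUbar.1, by rwa [mem_ball, dist_eq_norm]⟩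
      have heq : ‖e (u a).1 - e p‖ = ε' := le_antisymm hle hge
      show ‖W a‖ ^ 2 - (ε' ^ 2)⁻¹ = 0
      rw [hWnorm, heq, inv_pow, sub_self]
    · refine ContinuousOn.mono (fun z hz => (hfcont z hz).continuousWithinAt) ?_
      simpa only [setOf_mem_eq] using hclU
    · exact continuousOn_const
  -- Liouville: `φ` is constant, and positive at `z₀`, so `U = ℂ`
  have hconst : ∀ z, φ z = φ z₀ := fun z => subharmonic_liouville hφc hφ0 hφbdd hφ2 hφΔ z z₀
  have hφz₀ : 0 < φ z₀ := by
    rw [hφU z₀ hz₀]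
    exact (hfU z₀ hz₀).1
  have hall : ∀ z, z ∈ U := fun z => hφpos z (by rw [hconst z]; exact hφz₀)
  -- `Δ φ = 0`, so `DW = 0` and `W` is constant
  have hΔ0 : ∀ z, Δ φ z = 0 := by
    have hφeq : φ = fun _ => φ z₀ := funext hconst
    intro z
    rw [hφeq, laplacian_const]
    rfl
  have hDW0 : ∀ z, fderiv ℝ W z = 0 := by
    intro z
    have h := hΔφ z (hall z)
    rw [hΔ0 z] at h
    have h1 : ‖fderiv ℝ W z 1‖ ^ 2 = 0 := by
      nlinarith [sq_nonneg ‖fderiv ℝ W z 1‖, sq_nonneg ‖fderiv ℝ W z Complex.I‖]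
    have h2 : ‖fderiv ℝ W z Complex.I‖ ^ 2 = 0 := by
      nlinarith [sq_nonneg ‖fderiv ℝ W z 1‖, sq_nonneg ‖fderiv ℝ W z Complex.I‖]
    exact clm_eq_zero_of_apply_one_of_apply_I _
      (norm_eq_zero.1 (pow_eq_zero_iff two_ne_zero |>.1 h1))
      (norm_eq_zero.1 (pow_eq_zero_iff two_ne_zero |>.1 h2))
  have hWdiff : Differentiable ℝ W := fun z =>
    (hWsmooth z (hall z).1).differentiableAt two_ne_zero
  obtain ⟨z, z', hzz'⟩ := hne
  have hWeq : W z = W z' := is_const_of_fderiv_eq_zero hWdiff hDW0 z z'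
  apply hzz'
  have h1 : e (u z).1 - e p = e (u z').1 - e p := inversion_injective hWeq
  have h2 : e (u z).1 = e (u z').1 := sub_left_injective h1
  have hsrc : ∀ w, (u w).1 ∈ e.source := fun w => by
    rw [he, extChartAt_source]
    exact (hall w).1
  exact Subtype.ext (e.injOn (hsrc z) (hsrc z') h2)

end Confinement

/-! ### The registered stub -/

/-- **BUBBLE CONFINEMENT (maximum principle of the line).** For `J` standard on the punctured
`ε'`-ball (closed ball inside the chart target): a non-constant `C^∞` `J`-holomorphic
`u : ℂ → Σ ∖ p` whose image avoids SOME punctured chart-ball `B_η` (i.e. stays in a compact piece)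
avoids the whole standard collar `B_{ε'}`. Proof (`bubbleConfinement_of`): on `U = u⁻¹(B_{ε'})`
the map `w = ι ∘ (e − e p) ∘ u` is flat `J₀`-holomorphic into `ℝ⁴ = ℂ²` (`J = (ι∘(e−e p))^* J₀`
there), bounded (`‖w‖ ≤ 1/η`), `‖w‖ > 1/ε'` inside and `= 1/ε'` on `∂U`; so
`φ = max(‖w‖² − ε'⁻², 0)` is a bounded continuous function on `ℂ`, subharmonic where positive,
hence constant (comparison with `a + b log |z - z₀|` on annuli, `subharmonic_liouville`), hence
`0`: otherwise `U = ℂ` and `Δφ = 2(‖w_s‖² + ‖w_t‖²) = 0` makes `w`, hence `u`, constant,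
contradicting non-constancy. [folklore] -/
theorem stub_bubbleConfinement :
    ∀ (S : HomotopySphere 4) (p : S.carrier)
      (J : ∀ x : punctured p, TangentSpace (𝓡 4) x →L[ℝ] TangentSpace (𝓡 4) x) (ε' : ℝ),
      0 < ε' →
      Metric.closedBall (extChartAt (𝓡 4) p p) ε' ⊆ (extChartAt (𝓡 4) p).target →
      (∀ x : punctured p, InPuncturedChartBall p ε' x →
        ∀ (v : TangentSpace (𝓡 4) x) (b : EuclideanSpace ℝ (Fin 4)),
          inner ℝ (fderiv ℝ inversion (extChartAt (𝓡 4) p x.1 - extChartAt (𝓡 4) p p)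
            (mfderiv (𝓡 4) 𝓘(ℝ, EuclideanSpace ℝ (Fin 4))
              (fun z : punctured p => extChartAt (𝓡 4) p z.1) x (J x v))) b
          = stdSymplecticForm (fderiv ℝ inversion (extChartAt (𝓡 4) p x.1 - extChartAt (𝓡 4) p p)
            (mfderiv (𝓡 4) 𝓘(ℝ, EuclideanSpace ℝ (Fin 4))
              (fun z : punctured p => extChartAt (𝓡 4) p z.1) x v)) b) →
      ∀ (u : ℂ → punctured p), ContMDiff 𝓘(ℝ, ℂ) (𝓡 4) ∞ u → (∃ z z' : ℂ, u z ≠ u z') →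
        IsJHolomorphic (𝓡 4) J u →
        (∃ η : ℝ, 0 < η ∧ ∀ z : ℂ, ¬ InPuncturedChartBall p η (u z)) →
        ∀ z : ℂ, ¬ InPuncturedChartBall p ε' (u z) := by
  intro S p J ε' hε' hball hstd u hu hne hhol hη
  exact bubbleConfinement_of p J ε' hε' hball hstd u hu hne hhol hη

end Summit.SmoothPoincare4.SmoothPoincare4.Theorems.WitnessCharge.PencilIncompleteness
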